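import Literature.NumberTheory.EllipticCurves.ComplexMultiplicationBurungaleFlachFiniteProofs
import Literature.NumberTheory.EllipticCurves.ComplexMultiplicationTwistIsogenyCertProofs
import Literature.NumberTheory.EllipticCurves.ComplexMultiplicationShaHeckeProofs
import HarnessLib

/-!
# bsd.S28 (Burungale–Flach): the finiteness half of Theorem 1.1 over the CM field — census of
its leaves (Coates–Wiles 1977, Rubin 1987, Deuring, Knapp 11.67, Deuring–Hecke)

Sixth proof file of `Literature.NumberTheory.EllipticCurves.ComplexMultiplication` for
**bsd.S28**; sibling of `ComplexMultiplicationBurungaleFlachFiniteProofs.lean` (D-0014 append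
protocol: a new file, everything proved, no definitions). It concerns the named fact

* `Literature.NumberTheory.EllipticCurves.BurungaleFlach2024_finite_primary_cmField` —
  Burungale–Flach, Camb. J. Math. 12 (2024), **Prop. 4.1, last assertion** (arXiv p. 19:
  *"Moreover, the Selmer group `Sel(K, T_{𝓞_{L_𝔓}}(φ)(1))` is finite"*), as used in the proof of
  Thm. 1.1 (p. 22: *"it was shown in Prop. (descent) that the `p`-primary part of `Ш(E/F)` (and of
  `E(F)`) is finite for any prime `p`"*), at `F = K` for the base change `E_K` of a CM curve
  `E/ℚ` with `j(E) ∈ maximalCMJInvariants` and `L(E/ℚ, 1) ≠ 0`, on a globally minimal model `W'`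
  of `E_K`: `E(K) = W'(K)` and `Ш(E/K)[p^∞]` are finite for every rational prime `p`.

The paper's own attribution of this statement is **Remark 10** (p. 19): *"In the situation of
Prop. (descent) the finiteness of the Mordell–Weil group is due to Coates and Wiles [coates77],
Arthaud [arthuad78] and Rubin [rubin81]. For `L = K` the finiteness of the Tate–Shafarevich group
is due to Rubin [rubin87]"*, and the sibling file derived the fact from those classical theorems
(`BurungaleFlach2024_finite_primary_cmField_of_classical`, six named facts as hypotheses). Since
then two of the six inputs have been **discharged** in the tree — the Mordell–Weil theorem
(`WeierstrassCurve.module_finite_point_holds`, through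
`finite_point_of_j_mem_maximalCMJInvariants_of_L_one_ne_zero_of_CoatesWiles1977`) and the
`ℚ`-isogeny of a CM curve with its twist by the CM character
(`isIsogenous_quadraticTwist_cmFieldDiscr_holds`, six certified isogenies) — and the only use of
modularity (`WeierstrassCurve.hasEntireLFunction_rat`) is the existence of an entire continuation
of `L(E/ℚ, s)` for the CM curve `E` itself, which is Deuring–Hecke (Silverman, *Advanced
Topics*, Ch. II Cor. 10.5.1), vendored as `hasEntireLFunction_of_j_mem_maximalCMJInvariants` in
`ComplexMultiplicationShaHeckeProofs.lean`. This file records the resulting **census**: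

* `BurungaleFlach2024_finite_primary_cmField_of_hecke` (**proved**): the sibling's reduction with
  modularity weakened to the CM continuation (same proof, `hmod W` replaced by `hH W hj`);
* `BurungaleFlach2024_finite_primary_cmField_of_leaves` (**proved**): the fact follows,
  sorry-free, from exactly five named facts of the tree, each ONE printed statement:
  1. `CoatesWiles1977_L_one_eq_zero_of_not_isOfFinAddOrder` — Coates–Wiles, Invent. Math. 39
     (1977), Thm. 1 for `F = ℚ` (a rational point of infinite order forces `L(E/ℚ, 1) = 0`);
  2. `Rubin1987_sha_primary_finite` — Rubin, Invent. Math. 89 (1987), §10 (`Ш(E_K/K)[p^∞]` is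
     finite for every `p` when `L(E_K/K, 1) ≠ 0`);
  3. `LFunction_eq_of_isIsogenous` — Knapp, *Elliptic Curves*, Thm. 11.67 (isogenous curves over
     `ℚ` have the same `L`-function; used once, to move `L(E, 1) ≠ 0` to the twist `E^{(d_K)}`);
  4. `Deuring_LFunction_baseChange_cmField` — Deuring, `L(E_K/K, s) = L(E/ℚ, s)²` (Silverman,
     *Advanced Topics*, II Thm. 10.5);
  5. `hasEntireLFunction_of_j_mem_maximalCMJInvariants` — Deuring–Hecke, `L(E/ℚ, s)` is entire
     for CM by `𝓞_K` (Silverman, *Advanced Topics*, II Cor. 10.5.1);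
* `BurungaleFlach2024_finite_primary_cmField_of_leaves_of_hasEntireLFunction_rat` (bookkeeping):
  the same with leaf 5 fed from modularity, so nothing stronger than before enters the tree.

Everything else is proved in the tree: Mordell–Weil (Silverman *AEC* VIII.6.7), the CM twist
isogenies, finiteness of `E(K)` from `E(ℚ)` and `E^{(d_K)}(ℚ)` (the eigenspace decomposition,
*AEC* Exercise 10.16 with III.6.4), invariance of both finiteness statements under admissible
changes of variables over `K`, and `L(E_K/K, 1) = L(E/ℚ, 1)²` for the continuations.

**Triage of the discharge `BurungaleFlach2024_finite_primary_cmField_holds` (SIZE XL).** Leaves 1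
and 2 are the theorems of Coates–Wiles and Rubin themselves (elliptic units, the explicit
reciprocity law, `p`-adic `L`-functions and the descent of Rubin §§1–10; equivalently, in the
paper, Prop. 4.1: the two-variable main conjecture of Johnson-Leung–Kings, Thm. 4.1, descended by
Lemma 9); leaves 3–5 need the `ℓ`-adic local factors at every place (Serre–Tate), the
Grössencharacter of a CM curve and Hecke's continuation. None of this is in Mathlib or in the
tree, so the unconditional theorem is not asserted here; the leaves are decomposed further in
their own files (`ComplexMultiplicationCoatesWiles.lean`: Thm. 1 from the per-prime divisibility
`CoatesWiles1977_L_one_div_period_mem_prime`, Deuring's `a_p = π + π̄` and the CM period lattice,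
the last proved in `ComplexMultiplicationSingularModuliProofs.lean`;
`ComplexMultiplicationLFunctionIsogenyProofs.lean`: Knapp 11.67 from the Euler-factor schema
`hasseWeilEulerFactor_geomPoints`).

## References

* A. Burungale, M. Flach, *The conjecture of Birch and Swinnerton-Dyer for certain elliptic curves
  with complex multiplication*, Camb. J. Math. 12 (2024), no. 2 (arXiv:2206.09874): Thm. 1.1
  (p. 3), Prop. 4.1 and Remark 10 (p. 19), proof of Thm. 1.1 (p. 22). [BurungaleFlach2024]
* J. Coates, A. Wiles, *On the conjecture of Birch and Swinnerton-Dyer*, Invent. Math. 39 (1977),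
  Thm. 1 (p. 223). [CoatesWiles1977]
* K. Rubin, *Tate–Shafarevich groups and L-functions of elliptic curves with complex
  multiplication*, Invent. Math. 89 (1987), Thm. A (p. 527) and §10 (p. 549). [Rubin1987Sha]
* J. H. Silverman, *Advanced Topics in the Arithmetic of Elliptic Curves*, GTM 151 (1994), Ch. II
  Thm. 10.5 and Cor. 10.5.1. [SilvermanATAEC1994]
* A. W. Knapp, *Elliptic Curves*, Math. Notes 40 (1992), Thm. 11.67. [Knapp1993]
* J. H. Silverman, *The Arithmetic of Elliptic Curves*, 2nd ed., GTM 106 (2009), III.6.4,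
  VIII.6.7, X.§4, Exercise 10.16. [SilvermanAEC2009]
-/

noncomputable section

open scoped Classical

namespace Literature.NumberTheory.EllipticCurves

open WeierstrassCurve

/-- **Burungale–Flach 2024, Prop. 4.1 (finiteness half) at `F = K`, from its classical sources
with the Deuring–Hecke continuation in place of modularity.** Same statement and proof as
`BurungaleFlach2024_finite_primary_cmField_of_classical` (Remark 10 of the paper: Coates–Wiles
for `E(ℚ)` and `E^{(d_K)}(ℚ)`, hence `E(K)`; Rubin 1987 §10 for `Ш(E_K/K)[p^∞]`; transport to the
globally minimal model `W' = C • E_K`), except that the entire continuation of `L(E/ℚ, s)` needed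
to read `L(E_K/K, 1) = L(E/ℚ, 1)² ≠ 0` off Deuring's formal identity (`hD`) is taken from the CM
continuation `hH` (Silverman, *Advanced Topics*, II Cor. 10.5.1, the fact
`hasEntireLFunction_of_j_mem_maximalCMJInvariants`) for the CM curve `E` only, instead of
modularity for all curves over `ℚ`.
[cite: BurungaleFlach2024, Prop. 4.1 with Remark 10 (arXiv p. 19)]
[cite: CoatesWiles1977, Thm 1 (p. 223)] [cite: Rubin1987Sha, §10, proof of Thm. A, p. 549]
[cite: SilvermanATAEC1994, Ch. II Cor. 10.5.1] -/
theorem BurungaleFlach2024_finite_primary_cmField_of_hecke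
    (hF1 : finite_point_of_j_mem_maximalCMJInvariants_of_L_one_ne_zero)
    (hTW : isIsogenous_quadraticTwist_cmFieldDiscr) (hKn : LFunction_eq_of_isIsogenous)
    (hR : Rubin1987_sha_primary_finite) (hD : Deuring_LFunction_baseChange_cmField)
    (hH : hasEntireLFunction_of_j_mem_maximalCMJInvariants) :
    BurungaleFlach2024_finite_primary_cmField := by
  intro W _ hj hL K _ _ hK W' _ _ hW' p hp
  obtain ⟨C, rfl⟩ := hW'
  -- the square-root generator of the CM field: `θ² = d_K`, `θ ∉ ℚ`
  obtain ⟨θ, hθ⟩ := hK.2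
  have hd : cmFieldDiscr W.j < 0 := cmFieldDiscr_neg hj
  have hθ' : θ ∉ Set.range (algebraMap ℚ K) := by
    rintro ⟨q, hq⟩
    have h1 : (algebraMap ℚ K) (q ^ 2) = (algebraMap ℚ K) (cmFieldDiscr W.j : ℚ) := by
      rw [map_pow, hq, hθ, map_intCast]
    have h2 : q ^ 2 = (cmFieldDiscr W.j : ℚ) := (algebraMap ℚ K).injective h1
    have h3 : (0 : ℚ) ≤ q ^ 2 := sq_nonneg q
    have h4 : ((cmFieldDiscr W.j : ℤ) : ℚ) < 0 := by exact_mod_cast hd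
    linarith
  have hc : θ ^ 2 = algebraMap ℚ K (cmFieldDiscr W.j : ℚ) := by rw [hθ, map_intCast]
  have hd0 : (cmFieldDiscr W.j : ℚ) ≠ 0 := by exact_mod_cast hd.ne
  -- `E(ℚ)` and `E^{(d_K)}(ℚ)` are finite (Coates–Wiles, for `E` and for its twist)
  have hfinQ : Finite W.toAffine.Point := hF1 W hj hL
  haveI : (W.quadraticTwist (cmFieldDiscr W.j : ℚ)).IsElliptic := W.isElliptic_quadraticTwist hd0
  have hjd : (W.quadraticTwist (cmFieldDiscr W.j : ℚ)).j ∈ maximalCMJInvariants := by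
    rw [W.j_quadraticTwist hd0]
    exact hj
  have hLd : (W.quadraticTwist (cmFieldDiscr W.j : ℚ)).entireLFunction 1 ≠ 0 := by
    rw [← entireLFunction_eq_of_isIsogenous hKn (hTW W hj)]
    exact hL
  have hfinQd : Finite (W.quadraticTwist (cmFieldDiscr W.j : ℚ)).toAffine.Point :=
    hF1 (W.quadraticTwist (cmFieldDiscr W.j : ℚ)) hjd hLd
  -- hence `E(K)` is finite, and so is `W'(K) ≅ E(K)`
  have hfinK : Finite (W.baseChange K).toAffine.Point :=
    W.finite_point_baseChange_of_finite_of_finite_quadraticTwist hK.1 hθ' hc hfinQ hfinQd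
  have hfinW' : Finite (C • W.baseChange K).toAffine.Point :=
    Finite.of_equiv _ (VariableChange.pointEquiv (W.baseChange K) C).toEquiv
  -- `L(E_K/K, 1) = L(E/ℚ, 1)² ≠ 0` (Deuring, and the Deuring–Hecke continuation of `L(E/ℚ, s)`),
  -- so Rubin 1987 §10 applies to `E_K`
  have hLK : (W.baseChange K).entireLFunction 1 ≠ 0 := by
    rw [entireLFunction_one_eq_sq_of_LFunction_eq_mul_self (hH W hj) (hD W hj K hK)]
    exact pow_ne_zero 2 hL
  have hprim : Set.Finite {c : (W.baseChange K).sha | ∃ j : ℕ, p ^ j • c = 0} :=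
    hR W hj K hK hLK p hp
  exact ⟨hfinW', ((W.baseChange K).finite_sha_primary_variableChange_iff C p).mpr hprim⟩

/-- **Census: the finiteness half of Burungale–Flach's Theorem 1.1 at `F = K` rests on exactly
five printed statements.** `BurungaleFlach2024_finite_primary_cmField` follows, sorry-free, from
Coates–Wiles 1977, Thm. 1 for `F = ℚ` in its printed form (`hCW`), Rubin 1987, §10 for `E_K`
(`hR`), Knapp's Thm. 11.67 (`hKn`), Deuring's `L(E_K/K, s) = L(E/ℚ, s)²` (`hD`) and the
Deuring–Hecke continuation of `L(E/ℚ, s)` for CM by `𝓞_K` (`hH`) — the Mordell–Weil theorem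
(`WeierstrassCurve.module_finite_point_holds`, through
`finite_point_of_j_mem_maximalCMJInvariants_of_L_one_ne_zero_of_CoatesWiles1977`) and the
`ℚ`-isogenies `E ∼ E^{(d_K)}` (`isIsogenous_quadraticTwist_cmFieldDiscr_holds`) being proved in
the tree. This is Remark 10 of the paper made precise for `F = L = K`.
[cite: BurungaleFlach2024, Prop. 4.1 with Remark 10 (arXiv p. 19) and proof of Thm. 1.1 (p. 22)]
[cite: CoatesWiles1977, Thm 1 (p. 223)] [cite: Rubin1987Sha, §10, proof of Thm. A, p. 549]
[cite: Knapp1993, Thm. 11.67] [cite: SilvermanATAEC1994, Ch. II Thm. 10.5 and Cor. 10.5.1] -/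
theorem BurungaleFlach2024_finite_primary_cmField_of_leaves
    (hCW : CoatesWiles1977_L_one_eq_zero_of_not_isOfFinAddOrder)
    (hR : Rubin1987_sha_primary_finite) (hKn : LFunction_eq_of_isIsogenous)
    (hD : Deuring_LFunction_baseChange_cmField)
    (hH : hasEntireLFunction_of_j_mem_maximalCMJInvariants) :
    BurungaleFlach2024_finite_primary_cmField :=
  BurungaleFlach2024_finite_primary_cmField_of_hecke
    (finite_point_of_j_mem_maximalCMJInvariants_of_L_one_ne_zero_of_CoatesWiles1977 hCW)
    isIsogenous_quadraticTwist_cmFieldDiscr_holds hKn hR hD hH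

/-- Bookkeeping: the census with the continuation leaf fed from modularity
(`WeierstrassCurve.hasEntireLFunction_rat`, of which the CM continuation is the special case
`hasEntireLFunction_of_j_mem_maximalCMJInvariants_of_hasEntireLFunction_rat`), i.e. the sibling's
`BurungaleFlach2024_finite_primary_cmField_of_classical` with its two discharged inputs removed.
[cite: BurungaleFlach2024, Prop. 4.1 with Remark 10 (arXiv p. 19)] [cite: BCDTJAMS2001, Theorem A] -/
theorem BurungaleFlach2024_finite_primary_cmField_of_leaves_of_hasEntireLFunction_rat
    (hCW : CoatesWiles1977_L_one_eq_zero_of_not_isOfFinAddOrder)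
    (hR : Rubin1987_sha_primary_finite) (hKn : LFunction_eq_of_isIsogenous)
    (hD : Deuring_LFunction_baseChange_cmField) (hmod : hasEntireLFunction_rat) :
    BurungaleFlach2024_finite_primary_cmField :=
  BurungaleFlach2024_finite_primary_cmField_of_leaves hCW hR hKn hD
    (hasEntireLFunction_of_j_mem_maximalCMJInvariants_of_hasEntireLFunction_rat hmod)

end Literature.NumberTheory.EllipticCurves

end
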